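import Literature.AnabelianGeometry.EtaleTheta.KummerTwistInertia
import Literature.IUT.HodgeTheaters.GlobalFrobenioidsCoricRigidityGenuineKummer
import HarnessLib

/-!
# [IUTchI] Example 5.1 (v), pp. 127–128: law (b′) "divisors of Kummer classes" REDUCED TO THE INERTIA LAW;
# the ∞κ uniqueness at the genuine Kummer map modulo inertia data only (proof-only)

S. Mochizuki, *Inter-universal Teichmüller theory I*, kurims manuscript (May 2020), §5 Example 5.1 (v), p. 127
l. 76 – p. 128 l. 2 ([IUTchI] Ex 5.1 (v) p.127) [claim: Mochizuki2012, status: disputed]: "the natural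
isomorphism … [is obtained] by considering divisors of zeroes and poles [cf. the definition of a '`κ`-coric
function' given in Remark 3.1.7, (i)] associated to Kummer classes of rational functions as in [AbsTopIII],
Proposition 1.6, (iii), from the elementary observation that … `ℚ_{>0} ∩ Ẑ^× = {1}`"; and *Topics in Absolute
Anabelian Geometry III*, Prop. 1.6 (iii) p. 36 [MochizukiAbsTopIII2015]: the Kummer class of a rational function,
restricted to the decomposition/inertia group of a closed point, records the ORDER of the function at the point.

Sub-DAG `plan/L5/SUBDAG-IUTchI-Ex51.md` rows E51/L27 (b′) ⇒ E51/L29; GAP-LEDGER G-w4d056-2 — (b′) was the row's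
LAST OPEN LAW.  PROOF-ONLY: theorems, no definition, no instance, no new `Prop` fact.

**State before this file.**  `NFBridgeRecon.existsUniqueCoricStructure_infκPair_kummerMap` (abc-iut-w4-d056,
p432037) proves the boxed uniqueness at the GENUINE Kummer map from: injectivity (E51/L26), (b′) `hord` — "if
`κ(f′) = u · κ(f)` for `π₁^rat`-fixed ∞κ-coric `f, f′` and `u ∈ Ẑ^×`, then `u(η(ord_x f)) = η(ord_x f′)` at every
point `x`" — a law quantifying over the Kummer CONTAINER and over `u`, and Rmk 3.1.7 (i)/(ii) `hpole`/`hex`.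

**What this file proves.**  (b′) is a THEOREM (`NFBridgeRecon.kummerMap_hord_of_inertia`) from three laws about
the genuine Galois action `π₁^rat ↷ K_rat` ALONE — for each point `x` an element `τ_x ∈ π₁^rat` [a topological
generator of the inertia group at a point above `x`] with:
 (i)  `τ_x` FIXES EVERY ROOT OF UNITY of `K_rat` [inertia at a point of a curve over a field of characteristic
      `0` acts trivially on the constants];
 (ii) some positive power of `τ_x` lies in every level `S j` [the levels have finite index];
 (iii) for every `π₁^rat`-fixed ∞κ-coric `f` [a genuine rational function] and every compatible system `y` of
      roots of `f`: `τ_x(yₙ)/yₙ = ξ_{x,n}^{ord_x f}` with `ξ_{x,n}` a primitive `n`-th root of unity for every `n`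
      [`ξ_x` = the image of `τ_x` under `I_x ≅ Ẑ(1)`; THIS is [AbsTopIII] Prop. 1.6 (iii)'s content: restricted
      to inertia, the Kummer class of `f` is `ord_x(f)` times the generator].
Engine: abc-iut-w4-d056's `apply_eta_eq_eta_of_kummerMap_eq_twist` (`KummerTwistInertia.lean`: equality in the
direct limit ⇒ equality at a deep level ⇒ the cocycles differ by a coboundary, which VANISHES at `τ_x^k` by (i) ⇒
`ξ^{k·ord f′} = u·ξ^{k·ord f}` ⇒ `u(η(ord f)) = η(ord f′)`, `Ẑ` being determined by its levels).  Hence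
`NFBridgeRecon.existsUniqueCoricStructure_infκPair_of_inertia`: **the ∞κ uniqueness of Ex. 5.1 (v) at the
genuine Kummer map with NO container-level law** — hypotheses: structural side conditions, injectivity of the
Kummer map (E51/L26), the inertia data (i)–(iii), and Rmk 3.1.7 (i)/(ii) in divisor form (theorems at
abc-iut-L5-t2's typing).  The "respectively ∞κ×" clause is not covered (see `GlobalFrobenioidsCoricKummerNaturality`).
No side is taken on [IUTchIII] Cor. 3.12; nothing of the disputed series is asserted; typed ≠ proved.
-/

namespace Literature.IUT.HodgeTheaters

open ProfiniteGrp ProfiniteGrp.ProfiniteCompletion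
open Literature.AnabelianGeometry.EtaleTheta Literature.AnabelianGeometry.EtaleTheta.ZHatLevel

namespace NFBridgeRecon

variable (N : NFBridgeRecon.{0}) [MulDistribMulAction N.piRat N.Kratˣ] {ι : Type} [Preorder ι]
  [DecidableEq ι] [IsDirectedOrder ι] (S : ι → Subgroup N.piRat) (hS : ∀ ⦃i j : ι⦄, i ≤ j → S j ≤ S i)
  [RootableBy N.Kratˣ ℕ]

omit [RootableBy N.Kratˣ ℕ] in
/-- A `π₁^rat`-fixed nonzero rational function is invariant, as a unit, under every level (for a units action
compatible with the field action). ([IUTchI] Ex 5.1 (v) p.127) [claim: Mochizuki2012, status: disputed] -/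
theorem mk0_mem_invariants_of_fixed
    (hcoe : ∀ (g : N.piRat) (a : N.Kratˣ), ((g • a : N.Kratˣ) : N.Krat) = g • (a : N.Krat))
    {f : N.Krat} (hf0 : f ≠ 0) (hfix : ∀ g : N.piRat, g • f = f) (H : Subgroup N.piRat) :
    Units.mk0 f hf0 ∈ invariants (A := N.Kratˣ) H := fun γ =>
  Units.ext (by rw [show ((γ • Units.mk0 f hf0 : N.Kratˣ) : N.Krat) = ((γ : N.piRat) • Units.mk0 f hf0 : N.Kratˣ)
    from rfl, hcoe, Units.val_mk0, hfix])

/-- **LAW (b′) OF [IUTchI] Ex. 5.1 (v) AS A THEOREM OF THE INERTIA LAW** ("divisors of zeroes and poles …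
associated to Kummer classes of rational functions as in [AbsTopIII], Proposition 1.6, (iii)").  Given, for each
point `x`, an element `τ_x ∈ π₁^rat` that (i) fixes every root of unity of `K_rat`, (ii) has a positive power in
every level `S j`, and (iii) acts on the compatible roots `y` of every `π₁^rat`-fixed ∞κ-coric `f` by
`τ_x(yₙ)/yₙ = ξ_{x,n}^{ord_x f}` (`ξ_{x,n}` primitive `n`-th roots): whenever `κ(f′) = u · κ(f)` in the genuine
container (`kummerMap`, `H1ColimTwist`) for `π₁^rat`-fixed ∞κ-coric `f, f′` and `u ∈ Ẑ^× = Aut(Ẑ)`, one has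
`u(η(ord_x f)) = η(ord_x f′)` at every point `x` — hypothesis `hord` of `existsUniqueCoricStructure_infκPair_kummerMap`.
PROVED. ([IUTchI] Ex 5.1 (v) p.127) [claim: Mochizuki2012, status: disputed] -/
theorem kummerMap_hord_of_inertia [Nonempty ι]
    (hcoe : ∀ (g : N.piRat) (a : N.Kratˣ), ((g • a : N.Kratˣ) : N.Krat) = g • (a : N.Krat))
    (hc : IsExhausted N.Kratˣ S) {X : Type*} (ord : X → N.Krat → ℤ) (τ : X → N.piRat)
    (hτμ : ∀ (x : X) (ζ : N.Kratˣ) (n : ℕ+), ζ ^ (n : ℕ) = 1 → τ x • ζ = ζ)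
    (hτS : ∀ (x : X) (j : ι), ∃ k : ℕ, 0 < k ∧ τ x ^ k ∈ S j)
    (ξ : X → ℕ+ → N.Kratˣ) (hξ : ∀ (x : X) (n : ℕ+), IsPrimitiveRoot (ξ x n) n)
    (hval : ∀ (x : X) (f : N.Krat) (hf0 : f ≠ 0), f ∈ N.Minfκ → (∀ g : N.piRat, g • f = f) →
      ∀ (y : RootSystem (Units.mk0 f hf0)) (n : ℕ+), τ x • y.root n / y.root n = (ξ x n) ^ (ord x f))
    (u : MulAut (completion (GrpCat.of (Multiplicative ℤ)))) (f f' : N.infκPair.carrier)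
    (hf : ∀ g : N.piRat, g • (f : N.Krat) = f) (hf' : ∀ g : N.piRat, g • (f' : N.Krat) = f')
    (h : kummerMap hS hc (Units.mk0 (f' : N.Krat) (N.coe_infκPair_ne_zero f')) =
      H1ColimTwist S hS u (kummerMap hS hc (Units.mk0 (f : N.Krat) (N.coe_infκPair_ne_zero f))))
    (x : X) : u (eta (ord x f)) = eta (ord x f') := by
  obtain ⟨i⟩ := ‹Nonempty ι›
  exact apply_eta_eq_eta_of_kummerMap_eq_twist S hS hc
    (N.mk0_mem_invariants_of_fixed hcoe (N.coe_infκPair_ne_zero f) hf (S i))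
    (N.mk0_mem_invariants_of_fixed hcoe (N.coe_infκPair_ne_zero f') hf' (S i)) u h (τ x) (hτμ x) (hτS x)
    (ξ x) (hξ x) (RootSystem.ofRootableBy _) (hval x f _ f.2 hf _) (RootSystem.ofRootableBy _)
    (hval x f' _ f'.2 hf' _)

/-- **[IUTchI] Ex. 5.1 (v): `ExistsUniqueCoricStructure π₁^rat 𝕄^⊛_∞κ(†𝒟^⊚)` at the GENUINE Kummer map, with
law (b′) replaced by the INERTIA DATA at the points** — no hypothesis mentions the Kummer container, a Kummer
realisation, or an element of `Ẑ^×`.  Hypotheses: structural (`hcoe`; `S` directed exhaustive system of normal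
subgroups; `K_rat^×` rootable with all roots of unity; `1 ∈ 𝕄^⊛_∞κ`, `f ∈ 𝕄^⊛_∞κ ⇔ fⁿ ∈ 𝕄^⊛_∞κ`), injectivity of
the Kummer map (E51/L26), the inertia laws (i) `hτμ`, (ii) `hτS`, (iii) `hval` ([AbsTopIII] Prop. 1.6 (iii)), and
Rmk 3.1.7 (i)/(ii) `hpole`/`hex` on the `π₁^rat`-fixed ∞κ-coric functions.  PROVED
(`existsUniqueCoricStructure_infκPair_kummerMap` + `kummerMap_hord_of_inertia`).
([IUTchI] Ex 5.1 (v) p.128) [claim: Mochizuki2012, status: disputed] -/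
theorem existsUniqueCoricStructure_infκPair_of_inertia [Nonempty ι] [hN : ∀ i, (S i).Normal]
    (hcoe : ∀ (g : N.piRat) (a : N.Kratˣ), ((g • a : N.Kratˣ) : N.Krat) = g • (a : N.Krat))
    (hprim : ∀ n : ℕ, 0 < n → ∃ ζ : N.Krat, IsPrimitiveRoot ζ n) (hc : IsExhausted N.Kratˣ S)
    (h1 : (1 : N.Krat) ∈ N.Minfκ) (hpow : ∀ (f : N.Krat) (n : ℕ), 0 < n → (f ∈ N.Minfκ ↔ f ^ n ∈ N.Minfκ))
    (hinj : Function.Injective (kummerMap hS hc))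
    {X : Type*} (ord : X → N.Krat → ℤ) (τ : X → N.piRat)
    (hτμ : ∀ (x : X) (ζ : N.Kratˣ) (n : ℕ+), ζ ^ (n : ℕ) = 1 → τ x • ζ = ζ)
    (hτS : ∀ (x : X) (j : ι), ∃ k : ℕ, 0 < k ∧ τ x ^ k ∈ S j)
    (ξ : X → ℕ+ → N.Kratˣ) (hξ : ∀ (x : X) (n : ℕ+), IsPrimitiveRoot (ξ x n) n)
    (hval : ∀ (x : X) (f : N.Krat) (hf0 : f ≠ 0), f ∈ N.Minfκ → (∀ g : N.piRat, g • f = f) →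
      ∀ (y : RootSystem (Units.mk0 f hf0)) (n : ℕ+), τ x • y.root n / y.root n = (ξ x n) ^ (ord x f))
    (hpole : ∀ f' ∈ N.Minfκ, (∀ g : N.piRat, g • f' = f') →
      ∀ x₁ x₂ : X, x₁ ≠ x₂ → ¬ (ord x₁ f' < 0 ∧ ord x₂ f' < 0))
    (hex : ∃ f ∈ N.Minfκ, (∀ g : N.piRat, g • f = f) ∧
      ∃ x₁ x₂ : X, x₁ ≠ x₂ ∧ 0 < ord x₁ f ∧ 0 < ord x₂ f) :
    ExistsUniqueCoricStructure N.piRat N.infκPair :=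
  N.existsUniqueCoricStructure_infκPair_kummerMap S hS hcoe hprim hc h1 hpow hinj ord
    (fun u f f' hf hf' h x => N.kummerMap_hord_of_inertia S hS hcoe hc ord τ hτμ hτS ξ hξ hval u f f' hf hf' h x)
    hpole hex

/-- **Injectivity of the genuine Kummer map from "no divisible invariants"** (E51/L26 "the asserted injectivity
follows immediately from the corresponding injectivity in the case of `𝕄^⊛_∞κ(†𝒟^⊚)`", i.e. Kummer theory of the
fixed fields): if at every level `S i` an `S i`-invariant unit admitting `S i`-invariant `n`-th roots for all
`n ≥ 1` is trivial [`⋂ₙ (K_i^×)ⁿ = 1` for the fixed field `K_i` — a function field over a number field], then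
`kummerMap` is injective on `K_rat^×` (L2 `kummerMapHom_injective_of`, [AbsTopIII] Def. 1.5 (a) level-wise).
([IUTchI] Ex 5.1 (v) p.127) [claim: Mochizuki2012, status: disputed] -/
theorem kummerMap_injective_of_fixedRoots (hc : IsExhausted N.Kratˣ S)
    (hdiv : ∀ (i : ι) (a : N.Kratˣ), a ∈ invariants (A := N.Kratˣ) (S i) →
      (∀ n : ℕ+, ∃ b ∈ invariants (A := N.Kratˣ) (S i), b ^ (n : ℕ) = a) → a = 1) :
    Function.Injective (kummerMap hS hc) := fun a b hab =>
  Additive.ofMul.injective (kummerMapHom_injective_of S hS hc hdiv (a₁ := Additive.ofMul a)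
    (a₂ := Additive.ofMul b) hab)

include hS in
/-- **[IUTchI] Ex. 5.1 (v), ∞κ case, modulo laws of the genuine Galois action `π₁^rat ↷ K_rat` ONLY**: the boxed
uniqueness `ExistsUniqueCoricStructure π₁^rat 𝕄^⊛_∞κ(†𝒟^⊚)` from — besides the structural side conditions and
Rmk 3.1.7 (i)/(ii) in divisor form — (i) `hτμ` inertia fixes the roots of unity, (ii) `hτS` finite index of the
levels on inertia, (iii) `hval` inertia reads the orders of rational functions on their roots ([AbsTopIII]
Prop. 1.6 (iii)), (iv) `hdiv` no `S i`-invariant unit other than `1` has `S i`-invariant roots of all orders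
(Kummer theory of the fixed fields, E51/L26).  No Kummer container, realisation, `Ẑ^×`-element or naturality law
is assumed.  PROVED. ([IUTchI] Ex 5.1 (v) p.128) [claim: Mochizuki2012, status: disputed] -/
theorem existsUniqueCoricStructure_infκPair_of_inertia_of_fixedRoots [Nonempty ι] [hN : ∀ i, (S i).Normal]
    (hcoe : ∀ (g : N.piRat) (a : N.Kratˣ), ((g • a : N.Kratˣ) : N.Krat) = g • (a : N.Krat))
    (hprim : ∀ n : ℕ, 0 < n → ∃ ζ : N.Krat, IsPrimitiveRoot ζ n) (hc : IsExhausted N.Kratˣ S)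
    (h1 : (1 : N.Krat) ∈ N.Minfκ) (hpow : ∀ (f : N.Krat) (n : ℕ), 0 < n → (f ∈ N.Minfκ ↔ f ^ n ∈ N.Minfκ))
    (hdiv : ∀ (i : ι) (a : N.Kratˣ), a ∈ invariants (A := N.Kratˣ) (S i) →
      (∀ n : ℕ+, ∃ b ∈ invariants (A := N.Kratˣ) (S i), b ^ (n : ℕ) = a) → a = 1)
    {X : Type*} (ord : X → N.Krat → ℤ) (τ : X → N.piRat)
    (hτμ : ∀ (x : X) (ζ : N.Kratˣ) (n : ℕ+), ζ ^ (n : ℕ) = 1 → τ x • ζ = ζ)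
    (hτS : ∀ (x : X) (j : ι), ∃ k : ℕ, 0 < k ∧ τ x ^ k ∈ S j)
    (ξ : X → ℕ+ → N.Kratˣ) (hξ : ∀ (x : X) (n : ℕ+), IsPrimitiveRoot (ξ x n) n)
    (hval : ∀ (x : X) (f : N.Krat) (hf0 : f ≠ 0), f ∈ N.Minfκ → (∀ g : N.piRat, g • f = f) →
      ∀ (y : RootSystem (Units.mk0 f hf0)) (n : ℕ+), τ x • y.root n / y.root n = (ξ x n) ^ (ord x f))
    (hpole : ∀ f' ∈ N.Minfκ, (∀ g : N.piRat, g • f' = f') →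
      ∀ x₁ x₂ : X, x₁ ≠ x₂ → ¬ (ord x₁ f' < 0 ∧ ord x₂ f' < 0))
    (hex : ∃ f ∈ N.Minfκ, (∀ g : N.piRat, g • f = f) ∧
      ∃ x₁ x₂ : X, x₁ ≠ x₂ ∧ 0 < ord x₁ f ∧ 0 < ord x₂ f) :
    ExistsUniqueCoricStructure N.piRat N.infκPair :=
  N.existsUniqueCoricStructure_infκPair_of_inertia S hS hcoe hprim hc h1 hpow
    (N.kummerMap_injective_of_fixedRoots S hS hc hdiv) ord τ hτμ hτS ξ hξ hval hpole hex

end NFBridgeRecon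

end Literature.IUT.HodgeTheaters
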